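import Summits.BirchSwinnertonDyer.BirchSwinnertonDyer.Theorems.EdixhovenFibreFiveSevenStarredOptimalManinUnitFiveSevenRecTowerAtCyclotomicOverCompletion
import Summits.BirchSwinnertonDyer.BirchSwinnertonDyer.Theorems.EdixhovenFibreFiveSevenDeRhamAtFiveSevenPotentiallyGood
import HarnessLib

/-!
# [REC-tower] AT THE CYCLOTOMIC TOWER `ℚ_v ⊆ ℚ(ζ_m)_w` from Kato's formula over a completion `K_{w′}` — GENERIC in the curve (one de Rham input),
# and turnkey on ALL TWELVE potentially good additive cells at `p ∈ {5, 7}` (route `EdixhovenFibreFiveSeven`, line `kato-lever`; seat `bsd-line-edix-p4` g31, width)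

HONEST FRAMING. TOOL theorems only (no definition, no named fact, no instance, no `sorry`; file-local instance keys on `ℚ_v` byte-identical to
`…RecTowerAtCyclotomicOverCompletion` l.57–61); helper toward CORNER (stmt-BirchSwinnertonDyer-23883) / TDS57 (stmt-BirchSwinnertonDyer-22227); nothing is
closed; BSD / K★ / CORNER / TDS57 are NOT proved by this.

WHAT. `…RecTowerAtCyclotomicOverCompletion.recTowerAt_cyclotomic_cells_of_formula_over_completion` (LEAD g30) is the turnkey used by the cell provers of K★
(`…RecTowerCellsOfLocalFormulaAlt`): Kato's formula for the direct representation over the completion `K_{w′}` of a number field `K ⊇ ℚ(ζ_m)` ⟹ the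
[REC-tower] body at `ℚ_v ⊆ ℚ(ζ_m)_w`. It is keyed to the six STARRED K★ cells only because its de Rham input was `isDeRham_place_of_starredCell`; the
underlying `…RecTowerAtCyclotomicOverExt.recTowerAt_cyclotomic_of_formula_over_ext` takes ONE de Rham hypothesis `hDRv` at `ℚ_v` and nothing else about
the curve. This file records:

* ★★★ `recTowerAt_cyclotomic_of_formula_over_completion` — the turnkey for ANY elliptic `W/ℚ` GRANTED `hDRv` (de Rham-ness of `V_pW|_{Γ_{ℚ_v}}` in the
  place keys): verbatim the g30 statement with the cell binders replaced by `hDRv`.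
* ★ `isDeRham_place_of_potGoodFiveSeven` — `hDRv` HOLDS for every globally minimal `W/ℚ` with `p ∈ {5, 7}`, additive reduction at `p`, `E[p]` irreducible
  and no `Iₙ*` fibre at `p` (ALL twelve potentially good cells II, III, IV, IV*, III*, II* at `5` and `7`): the tree theorem
  `DeRhamAtFiveSeven.isDeRham_adicCompletion_rat_fiveSeven` (g19) read for the tree's `ℚ`-algebra structure `Place.instAlgebraCompletion` on `ℚ_v`
  (any two `ℚ`-algebra structures on a ring coincide), exactly as `isDeRham_place_of_starredCell` reads the starred half.
* ★★★ `recTowerAt_cyclotomic_potGoodFiveSeven_of_formula_over_completion` — the turnkey on all twelve cells (no `4 < ord_p Δ_min`): the UNSTARRED cells'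
  REC bodies (next file of this seat) plug Kato's local formula (`…LocalFormulaUnstarredOrdinaryCells`, this seat; the ss numerology theorem of g30) in here.

References: [Kato1993LNM1553] Ch. II §1.2.4, Prop. 1.2.3, Ex. 1.3.5, Thm. 1.4.1 (4); [BrinonConrad2009] Prop. 6.3.8; [CasselsFrohlichANT1967] Ch. II §10 (10.2);
[Fontaine1982FormesDifferentielles] §5; [DokchitserDokchitser2015LocalInvariants] Thm. 3.2.
-/

set_option autoImplicit false
-- the Theorems namespace of a single-conjunct summit repeats the summit name by design (D-0017)
set_option linter.dupNamespace false

noncomputable section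

open scoped Classical NNReal TensorProduct NumberField
open CategoryTheory Function Field ValuativeRel IsDedekindDomain NumberField
open Literature.NumberTheory.GaloisRepresentations
open Literature.NumberTheory.GaloisRepresentations.IsNonarchimedeanLocalField
open Literature.NumberTheory.GaloisRepresentations.PeriodRingData
open Literature.NumberTheory.PAdicHodge
open Literature.NumberTheory.EllipticCurves _root_.WeierstrassCurve
open Literature.NumberTheory.EllipticCurves.FormalGroupChart (padicLogPointFiniteExt)
open Summit.BirchSwinnertonDyer.BirchSwinnertonDyer.Theorems.StarredOptimalManinUnitFiveSevenRecTowerAtCyclotomicOverExt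
open Summit.BirchSwinnertonDyer.BirchSwinnertonDyer.Theorems.KimAtThreeDeepLowerExpStarOmega
open Summit.BirchSwinnertonDyer.BirchSwinnertonDyer.Theorems.KimAtThreeDeepLowerExpStarOmegaPlace
open Summit.BirchSwinnertonDyer.BirchSwinnertonDyer.Theorems.KimAtThreeDeepUpperTowerLattice (fact_natCast_mem_primesEquiv_symm)
open Summit.BirchSwinnertonDyer.Rank1Residual.GaloisImage
open Rat.HeightOneSpectrum Literature.NumberTheory.DiophantineGeometry
open Summit.BirchSwinnertonDyer.Rank1Residual Summit.BirchSwinnertonDyer.Rank1Residual.Additive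
  Literature.NumberTheory.EllipticCurves.Rank1Residual
open Literature.NumberTheory.AdelicBaseChange
open Summit.BirchSwinnertonDyer.BirchSwinnertonDyer.Theorems

namespace Summit.BirchSwinnertonDyer.BirchSwinnertonDyer.Theorems.RecTowerAtCyclotomicOverCompletionOfIsDeRham

variable (W : WeierstrassCurve ℚ) [W.IsElliptic] (p : ℕ) [hp : Fact p.Prime]

-- FILE-LOCAL instance keys, byte-identical to the accepted `…RecTowerAtCyclotomicOverCompletion.lean` l.57–61 (no library instance is
-- overridden outside this file): the `Fact (p ∈ v_p)` key and the local-field structures on `ℚ_v = Place.Completion (inr v_p)`.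
attribute [local instance] fact_natCast_mem_primesEquiv_symm
attribute [local instance 100000] NumberField.Place.instAlgebraCompletion
attribute [local instance] valuativeRelPlace topologicalSpacePlace
attribute [local instance] isNonarchimedeanLocalField_place charZero_place
attribute [local instance] padicAlgebraPlace fact_not_isUnit_place isAdicComplete_place

/-! ## §1 The turnkey for ANY elliptic `W/ℚ`, one de Rham input -/

/-- ★★★ **[REC-tower] at `ℚ_v ⊆ ℚ(ζ_m)_w` from Kato's formula over the COMPLETION `K_{w′}` of a number field `K ⊇ ℚ(ζ_m)`, for ANY elliptic `W/ℚ`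
GRANTED de Rham-ness `hDRv` of `V_pW|_{Γ_{ℚ_v}}`.** Verbatim `recTowerAt_cyclotomic_cells_of_formula_over_completion` (LEAD g30) with its K★-cell binders
replaced by `hDRv`: the structural inputs of `recTowerAt_cyclotomic_of_formula_over_ext` for `K′ := K_{w′}` (`Algebra L_w K_{w′}`, its continuity,
`FiniteDimensional L_w K_{w′}`, the keys) come from the adelic base-change packet; displayed is ONE analytic input, Kato's formula over `K_{w′}` for the
direct representation (`∀ d″ ∃ c′`, any compatible `ω′`). [cite: Kato1993LNM1553, Ch. II §1.2.4, Prop. 1.2.3, Ex. 1.3.5 and Thm. 1.4.1 (4)]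
[cite: BrinonConrad2009, Prop. 6.3.8] [cite: CasselsFrohlichANT1967, Ch. II §10 Theorem (10.2)] -/
theorem recTowerAt_cyclotomic_of_formula_over_completion
    (hDRv : GaloisRep.IsDeRham (bdRPeriodRingData (valuation_place_lt_one p ((primesEquiv (R := 𝓞 ℚ)).symm ⟨p, hp.out⟩)))
      (localRationalTateRep W p (galRestrictPlace ((primesEquiv (R := 𝓞 ℚ)).symm ⟨p, hp.out⟩))))
    (m : ℕ) [NeZero m]
    (w : ((primesEquiv (R := 𝓞 ℚ)).symm ⟨p, hp.out⟩).Extension (𝓞 (CyclotomicField m ℚ)))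
    (hw : ((p : ℕ) : 𝓞 (CyclotomicField m ℚ)) ∈ w.1.asIdeal)
    [CharZero (w.1.adicCompletion (CyclotomicField m ℚ))]
    [Fact (¬ IsUnit ((p : ℕ) : integerC (w.1.adicCompletion (CyclotomicField m ℚ))))]
    [IsAdicComplete (Ideal.span {((p : ℕ) : integerC (w.1.adicCompletion (CyclotomicField m ℚ)))}) (integerC (w.1.adicCompletion (CyclotomicField m ℚ)))]
    (hL : valuation (w.1.adicCompletion (CyclotomicField m ℚ)) ((p : ℕ) : (w.1.adicCompletion (CyclotomicField m ℚ))) < 1) :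
    letI := LocalField.adicCompletionPadicAlgebra w.1 p hw
    letI : Algebra (Place.Completion (K := ℚ) (Sum.inr ((primesEquiv (R := 𝓞 ℚ)).symm ⟨p, hp.out⟩))) (w.1.adicCompletion (CyclotomicField m ℚ)) :=
      inferInstanceAs (Algebra (((primesEquiv (R := 𝓞 ℚ)).symm ⟨p, hp.out⟩).adicCompletion ℚ) (w.1.adicCompletion (CyclotomicField m ℚ)))
    ∀ (wv : Valuation (Place.Completion (Sum.inr ((primesEquiv (R := 𝓞 ℚ)).symm ⟨p, hp.out⟩) : Place ℚ)) ℝ≥0) [wv.Compatible] [(W.baseChange (Place.Completion (Sum.inr ((primesEquiv (R := 𝓞 ℚ)).symm ⟨p, hp.out⟩) : Place ℚ))).IsIntegral wv.integer]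
      (ν : Valuation (w.1.adicCompletion (CyclotomicField m ℚ)) ℝ≥0) [ν.Compatible] [(W.baseChange (w.1.adicCompletion (CyclotomicField m ℚ))).IsIntegral ν.integer]
      -- the upper field: the completion `K_{w′}` of a number field `K ⊇ ℚ(ζ_m)` at a place `w′ ∣ w`, with the packet's keys
      {K : Type} [Field K] [NumberField K] [Algebra (CyclotomicField m ℚ) K] [FiniteDimensional (CyclotomicField m ℚ) K]
      (w' : w.1.Extension (𝓞 K)) (hw' : ((p : ℕ) : 𝓞 K) ∈ w'.1.asIdeal)
      [CharZero (w'.1.adicCompletion K)] [Fact (¬ IsUnit ((p : ℕ) : integerC (w'.1.adicCompletion K)))]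
      [IsAdicComplete (Ideal.span {((p : ℕ) : integerC (w'.1.adicCompletion K))}) (integerC (w'.1.adicCompletion K))]
      (hp' : valuation (w'.1.adicCompletion K) ((p : ℕ) : (w'.1.adicCompletion K)) < 1)
      (ω' : Valuation (w'.1.adicCompletion K) ℝ≥0) [ω'.Compatible] [(W.baseChange (w'.1.adicCompletion K)).IsIntegral ω'.integer],
    letI := LocalField.adicCompletionPadicAlgebra w'.1 p hw'
    -- the Weil tower
    ∀ (e : (k : ℕ) → geomTorsion W ((p ^ k : ℕ) : ℤ) → geomTorsion W ((p ^ k : ℕ) : ℤ) → AlgebraicClosure ℚ)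
    (hμ : ∀ k S T, e k S T ^ (p ^ k) = 1) (hadd₁ : ∀ k S₁ S₂ T, e k (S₁ + S₂) T = e k S₁ T * e k S₂ T)
    (hadd₂ : ∀ k S T₁ T₂, e k S (T₁ + T₂) = e k S T₁ * e k S T₂)
    (hgal : ∀ k (σ : absoluteGaloisGroup ℚ) (S T : geomTorsion W ((p ^ k : ℕ) : ℤ)), σ • e k S T = e k (σ • S) (σ • T))
    (hcompat : ∀ k (S T : geomTorsion W ((p ^ (k + 1) : ℕ) : ℤ)),
      e k (torsionMulHom W (p ^ (k + 1)) (p ^ k) p (pow_succ p k).symm S)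
        (torsionMulHom W (p ^ (k + 1)) (p ^ k) p (pow_succ p k).symm T) = e (k + 1) S T ^ p)
    (hnondeg : ∀ k (T : geomTorsion W ((p ^ k : ℕ) : ℤ)), (∀ S, e k S T = 1) → T = 0)
    -- binders of the tower representation over `F = L_w` (relative to `F₀ = ℚ_v`) — the stub's own
    (hinj : (bdRPeriodRingData (F := (w.1.adicCompletion (CyclotomicField m ℚ))) (p := p) hL).CupLogInjective (logCyclotomic p)
      ((restrictedRationalTateRep W (Place.Completion (Sum.inr ((primesEquiv (R := 𝓞 ℚ)).symm ⟨p, hp.out⟩) : Place ℚ)) p).restrict (absGaloisRestrict (Place.Completion (Sum.inr ((primesEquiv (R := 𝓞 ℚ)).symm ⟨p, hp.out⟩) : Place ℚ)) (w.1.adicCompletion (CyclotomicField m ℚ)))))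
    (hde : ∀ z : contOneCocycles ((restrictedRationalTateRep W (Place.Completion (Sum.inr ((primesEquiv (R := 𝓞 ℚ)).symm ⟨p, hp.out⟩) : Place ℚ)) p).restrict (absGaloisRestrict (Place.Completion (Sum.inr ((primesEquiv (R := 𝓞 ℚ)).symm ⟨p, hp.out⟩) : Place ℚ)) (w.1.adicCompletion (CyclotomicField m ℚ)))).toTopRep,
      (bdRPeriodRingData (F := (w.1.adicCompletion (CyclotomicField m ℚ))) (p := p) hL).HasDualExp (logCyclotomic p)
        ((restrictedRationalTateRep W (Place.Completion (Sum.inr ((primesEquiv (R := 𝓞 ℚ)).symm ⟨p, hp.out⟩) : Place ℚ)) p).restrict (absGaloisRestrict (Place.Completion (Sum.inr ((primesEquiv (R := 𝓞 ℚ)).symm ⟨p, hp.out⟩) : Place ℚ)) (w.1.adicCompletion (CyclotomicField m ℚ)))) fun σ => z.1 σ)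
    -- line data at `ℚ_v` and `L_w` with their compatibility — the stub's own
    (d₀ : (bdRPeriodRingData (F := (Place.Completion (Sum.inr ((primesEquiv (R := 𝓞 ℚ)).symm ⟨p, hp.out⟩) : Place ℚ))) (p := p) (valuation_place_lt_one p ((primesEquiv (R := 𝓞 ℚ)).symm ⟨p, hp.out⟩))).FilZeroLine (restrictedRationalTateRep W (Place.Completion (Sum.inr ((primesEquiv (R := 𝓞 ℚ)).symm ⟨p, hp.out⟩) : Place ℚ)) p))
    (d : (bdRPeriodRingData (F := (w.1.adicCompletion (CyclotomicField m ℚ))) (p := p) hL).FilZeroLine ((restrictedRationalTateRep W (Place.Completion (Sum.inr ((primesEquiv (R := 𝓞 ℚ)).symm ⟨p, hp.out⟩) : Place ℚ)) p).restrict (absGaloisRestrict (Place.Completion (Sum.inr ((primesEquiv (R := 𝓞 ℚ)).symm ⟨p, hp.out⟩) : Place ℚ)) (w.1.adicCompletion (CyclotomicField m ℚ)))))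
    (hcomp : ∀ (η₀ : contOneCocycles (restrictedTateRep W (Place.Completion (Sum.inr ((primesEquiv (R := 𝓞 ℚ)).symm ⟨p, hp.out⟩) : Place ℚ)) p).toTopRep)
        (η : contOneCocycles ((restrictedTateRep W (Place.Completion (Sum.inr ((primesEquiv (R := 𝓞 ℚ)).symm ⟨p, hp.out⟩) : Place ℚ)) p).restrict (absGaloisRestrict (Place.Completion (Sum.inr ((primesEquiv (R := 𝓞 ℚ)).symm ⟨p, hp.out⟩) : Place ℚ)) (w.1.adicCompletion (CyclotomicField m ℚ)))).toTopRep),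
        (∀ σ, η.1 σ = η₀.1 (absGaloisRestrict (Place.Completion (Sum.inr ((primesEquiv (R := 𝓞 ℚ)).symm ⟨p, hp.out⟩) : Place ℚ)) (w.1.adicCompletion (CyclotomicField m ℚ)) σ)) →
        expStarCoordTower W hL d η = algebraMap (Place.Completion (Sum.inr ((primesEquiv (R := 𝓞 ℚ)).symm ⟨p, hp.out⟩) : Place ℚ)) (w.1.adicCompletion (CyclotomicField m ℚ)) (expStarCoord W (valuation_place_lt_one p ((primesEquiv (R := 𝓞 ℚ)).symm ⟨p, hp.out⟩)) d₀ η₀))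
    -- Kato's formula over `K′` for the DIRECT representation: for every line datum SOME constant (the (K₂)^ram road's output shape)
    (hrecK' : ∀ d'' : (bdRPeriodRingData (F := (w'.1.adicCompletion K)) (p := p) hp').FilZeroLine (restrictedRationalTateRep W (w'.1.adicCompletion K) p), ∃ c' : (w'.1.adicCompletion K),
      ∀ (η'' : contOneCocycles (restrictedTateRep W (w'.1.adicCompletion K) p).toTopRep) (P' : (W.baseChange (w'.1.adicCompletion K)).toAffine.Point),
      ((tatePairingPoint W (w'.1.adicCompletion K) p e hμ hadd₁ hadd₂ hgal hcompat (oneCocycleClass _ η'') P' : ℤ_[p]) : ℚ_[p]) =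
        Algebra.trace ℚ_[p] (w'.1.adicCompletion K) (c' * expStarCoord W hp' d'' η'' * padicLogPointFiniteExt ω' (W.baseChange (w'.1.adicCompletion K)) p P')),
    ∃ c₀ : (Place.Completion (Sum.inr ((primesEquiv (R := 𝓞 ℚ)).symm ⟨p, hp.out⟩) : Place ℚ)), c₀ ≠ 0 ∧
      (∀ (η₀ : contOneCocycles (restrictedTateRep W (Place.Completion (Sum.inr ((primesEquiv (R := 𝓞 ℚ)).symm ⟨p, hp.out⟩) : Place ℚ)) p).toTopRep) (P₀ : (W.baseChange (Place.Completion (Sum.inr ((primesEquiv (R := 𝓞 ℚ)).symm ⟨p, hp.out⟩) : Place ℚ))).toAffine.Point),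
        ((tatePairingPoint W (Place.Completion (Sum.inr ((primesEquiv (R := 𝓞 ℚ)).symm ⟨p, hp.out⟩) : Place ℚ)) p e hμ hadd₁ hadd₂ hgal hcompat (oneCocycleClass _ η₀) P₀ : ℤ_[p]) : ℚ_[p]) =
          Algebra.trace ℚ_[p] (Place.Completion (Sum.inr ((primesEquiv (R := 𝓞 ℚ)).symm ⟨p, hp.out⟩) : Place ℚ))
            (c₀ * expStarCoord W (valuation_place_lt_one p ((primesEquiv (R := 𝓞 ℚ)).symm ⟨p, hp.out⟩)) d₀ η₀ * padicLogPointFiniteExt wv (W.baseChange (Place.Completion (Sum.inr ((primesEquiv (R := 𝓞 ℚ)).symm ⟨p, hp.out⟩) : Place ℚ))) p P₀)) ∧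
      ∀ (η : contOneCocycles ((restrictedTateRep W (Place.Completion (Sum.inr ((primesEquiv (R := 𝓞 ℚ)).symm ⟨p, hp.out⟩) : Place ℚ)) p).restrict (absGaloisRestrict (Place.Completion (Sum.inr ((primesEquiv (R := 𝓞 ℚ)).symm ⟨p, hp.out⟩) : Place ℚ)) (w.1.adicCompletion (CyclotomicField m ℚ)))).toTopRep)
        (P : (W.baseChange (w.1.adicCompletion (CyclotomicField m ℚ))).toAffine.Point),
        ((tatePairingPointTower W (Place.Completion (Sum.inr ((primesEquiv (R := 𝓞 ℚ)).symm ⟨p, hp.out⟩) : Place ℚ)) e hμ hadd₁ hadd₂ hgal hcompat (oneCocycleClass _ η) P : ℤ_[p]) : ℚ_[p]) =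
          Algebra.trace ℚ_[p] (w.1.adicCompletion (CyclotomicField m ℚ))
            (algebraMap (Place.Completion (Sum.inr ((primesEquiv (R := 𝓞 ℚ)).symm ⟨p, hp.out⟩) : Place ℚ)) (w.1.adicCompletion (CyclotomicField m ℚ)) c₀ * expStarCoordTower W hL d η * padicLogPointFiniteExt ν (W.baseChange (w.1.adicCompletion (CyclotomicField m ℚ))) p P) := by
  intro wv _ _ ν _ _ K _ _ _ _ w' hw' _ _ _ hp' ω' _ _
  exact recTowerAt_cyclotomic_of_formula_over_ext W p hDRv m w hw hL wv ν hp'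
    (w'.adicCompletionSemialgHom_continuous (CyclotomicField m ℚ) K) ω'

/-! ## §2 The de Rham input on all twelve potentially good cells at `p ∈ {5, 7}` -/

/-- ★ **`hDRv` HOLDS on every potentially good additive cell at `p ∈ {5, 7}`**, in the place keys of `ℚ_v`: for a globally minimal `W/ℚ` with
`p ∈ {5, 7}`, additive reduction at `p`, `E[p]` irreducible and no `Iₙ*` fibre at `p` (Kodaira II, III, IV, IV*, III*, II*), `V_pW|_{Γ_{ℚ_v}}` is de Rham —
`DeRhamAtFiveSeven.isDeRham_adicCompletion_rat_fiveSeven` (Fontaine's theorem assembled from the line's cell theorems: explicit good models over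
`ℚ_p(p^{1/e})`, the ordinary / supersingular capstones, twist transport) read for `Place.instAlgebraCompletion` (any two `ℚ`-algebra structures on `ℚ_v`
coincide). [cite: Fontaine1982FormesDifferentielles, §5] [cite: DokchitserDokchitser2015LocalInvariants, Thm. 3.2] [cite: Kato1993LNM1553, Ch. II Ex. 1.3.5] -/
theorem isDeRham_place_of_potGoodFiveSeven [W.IsGloballyMinimal] (hp57 : p = 5 ∨ p = 7) (hadd : Addv W p) (hirr : Irr W p)
    (hK : ∀ (v : HeightOneSpectrum ℤ) (n : ℕ), natGenerator v = p → W.kodairaSymbolAt v ≠ KodairaSymbol.Istar n) :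
    GaloisRep.IsDeRham (bdRPeriodRingData (valuation_place_lt_one p ((primesEquiv (R := 𝓞 ℚ)).symm ⟨p, hp.out⟩)))
      (localRationalTateRep W p (galRestrictPlace ((primesEquiv (R := 𝓞 ℚ)).symm ⟨p, hp.out⟩))) := by
  -- any two `ℚ`-algebra structures on `ℚ_v` coincide, so the restricted representation does not depend on the choice
  have hrep : ∀ (i₁ i₂ : Algebra ℚ ((((primesEquiv (R := 𝓞 ℚ)).symm ⟨p, hp.out⟩)).adicCompletion ℚ)),
      @restrictedRationalTateRep ℚ _ W _ _ i₁ p _ _ = @restrictedRationalTateRep ℚ _ W _ _ i₂ p _ _ :=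
    fun i₁ i₂ ↦ by rw [Subsingleton.elim i₁ i₂]
  have h0 := @DeRhamAtFiveSeven.isDeRham_adicCompletion_rat_fiveSeven p _ W _ _ hp57 hadd hirr hK
    ((primesEquiv (R := 𝓞 ℚ)).symm ⟨p, hp.out⟩) (fact_natCast_mem_primesEquiv_symm p).out (charZero_place _)
    (@fact_not_isUnit_place p _ (fact_natCast_mem_primesEquiv_symm p)) (@isAdicComplete_place p _ _ (fact_natCast_mem_primesEquiv_symm p))
    (@valuation_place_lt_one p _ (fact_natCast_mem_primesEquiv_symm p)) (@padicAlgebraPlace p _ _ (fact_natCast_mem_primesEquiv_symm p))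
  have h1 := (hrep (@DivisionRing.toRatAlgebra _ _ (charZero_place _)) (Place.instAlgebraCompletion (Sum.inr ((primesEquiv (R := 𝓞 ℚ)).symm ⟨p, hp.out⟩) : Place ℚ))) ▸ h0
  exact h1

/-! ## §3 The turnkey on all twelve cells -/

/-- ★★★ **[REC-tower] at `ℚ_v ⊆ ℚ(ζ_m)_w` from Kato's formula over `K_{w′}`, for every globally minimal `W/ℚ` with `p ∈ {5, 7}`, additive reduction at
`p`, `E[p]` irreducible and no `Iₙ*` fibre at `p`** — ALL twelve potentially good cells, starred or not (no `4 < ord_p Δ_min` binder): §1 with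
`hDRv := isDeRham_place_of_potGoodFiveSeven`. The socket into which the unstarred cells' local formulas are plugged.
[cite: Kato1993LNM1553, Ch. II §1.2.4, Prop. 1.2.3 and Thm. 1.4.1 (4)] [cite: Fontaine1982FormesDifferentielles, §5] [cite: CasselsFrohlichANT1967, Ch. II §10 Theorem (10.2)] -/
theorem recTowerAt_cyclotomic_potGoodFiveSeven_of_formula_over_completion [W.IsGloballyMinimal]
    (hp57 : p = 5 ∨ p = 7) (hadd : Addv W p) (hirr : Irr W p)
    (hK : ∀ (v : HeightOneSpectrum ℤ) (n : ℕ), natGenerator v = p → W.kodairaSymbolAt v ≠ KodairaSymbol.Istar n)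
    (m : ℕ) [NeZero m]
    (w : ((primesEquiv (R := 𝓞 ℚ)).symm ⟨p, hp.out⟩).Extension (𝓞 (CyclotomicField m ℚ)))
    (hw : ((p : ℕ) : 𝓞 (CyclotomicField m ℚ)) ∈ w.1.asIdeal)
    [CharZero (w.1.adicCompletion (CyclotomicField m ℚ))]
    [Fact (¬ IsUnit ((p : ℕ) : integerC (w.1.adicCompletion (CyclotomicField m ℚ))))]
    [IsAdicComplete (Ideal.span {((p : ℕ) : integerC (w.1.adicCompletion (CyclotomicField m ℚ)))}) (integerC (w.1.adicCompletion (CyclotomicField m ℚ)))]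
    (hL : valuation (w.1.adicCompletion (CyclotomicField m ℚ)) ((p : ℕ) : (w.1.adicCompletion (CyclotomicField m ℚ))) < 1) :
    letI := LocalField.adicCompletionPadicAlgebra w.1 p hw
    letI : Algebra (Place.Completion (K := ℚ) (Sum.inr ((primesEquiv (R := 𝓞 ℚ)).symm ⟨p, hp.out⟩))) (w.1.adicCompletion (CyclotomicField m ℚ)) :=
      inferInstanceAs (Algebra (((primesEquiv (R := 𝓞 ℚ)).symm ⟨p, hp.out⟩).adicCompletion ℚ) (w.1.adicCompletion (CyclotomicField m ℚ)))
    ∀ (wv : Valuation (Place.Completion (Sum.inr ((primesEquiv (R := 𝓞 ℚ)).symm ⟨p, hp.out⟩) : Place ℚ)) ℝ≥0) [wv.Compatible] [(W.baseChange (Place.Completion (Sum.inr ((primesEquiv (R := 𝓞 ℚ)).symm ⟨p, hp.out⟩) : Place ℚ))).IsIntegral wv.integer]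
      (ν : Valuation (w.1.adicCompletion (CyclotomicField m ℚ)) ℝ≥0) [ν.Compatible] [(W.baseChange (w.1.adicCompletion (CyclotomicField m ℚ))).IsIntegral ν.integer]
      -- the upper field: the completion `K_{w′}` of a number field `K ⊇ ℚ(ζ_m)` at a place `w′ ∣ w`, with the packet's keys
      {K : Type} [Field K] [NumberField K] [Algebra (CyclotomicField m ℚ) K] [FiniteDimensional (CyclotomicField m ℚ) K]
      (w' : w.1.Extension (𝓞 K)) (hw' : ((p : ℕ) : 𝓞 K) ∈ w'.1.asIdeal)
      [CharZero (w'.1.adicCompletion K)] [Fact (¬ IsUnit ((p : ℕ) : integerC (w'.1.adicCompletion K)))]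
      [IsAdicComplete (Ideal.span {((p : ℕ) : integerC (w'.1.adicCompletion K))}) (integerC (w'.1.adicCompletion K))]
      (hp' : valuation (w'.1.adicCompletion K) ((p : ℕ) : (w'.1.adicCompletion K)) < 1)
      (ω' : Valuation (w'.1.adicCompletion K) ℝ≥0) [ω'.Compatible] [(W.baseChange (w'.1.adicCompletion K)).IsIntegral ω'.integer],
    letI := LocalField.adicCompletionPadicAlgebra w'.1 p hw'
    -- the Weil tower
    ∀ (e : (k : ℕ) → geomTorsion W ((p ^ k : ℕ) : ℤ) → geomTorsion W ((p ^ k : ℕ) : ℤ) → AlgebraicClosure ℚ)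
    (hμ : ∀ k S T, e k S T ^ (p ^ k) = 1) (hadd₁ : ∀ k S₁ S₂ T, e k (S₁ + S₂) T = e k S₁ T * e k S₂ T)
    (hadd₂ : ∀ k S T₁ T₂, e k S (T₁ + T₂) = e k S T₁ * e k S T₂)
    (hgal : ∀ k (σ : absoluteGaloisGroup ℚ) (S T : geomTorsion W ((p ^ k : ℕ) : ℤ)), σ • e k S T = e k (σ • S) (σ • T))
    (hcompat : ∀ k (S T : geomTorsion W ((p ^ (k + 1) : ℕ) : ℤ)),
      e k (torsionMulHom W (p ^ (k + 1)) (p ^ k) p (pow_succ p k).symm S)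
        (torsionMulHom W (p ^ (k + 1)) (p ^ k) p (pow_succ p k).symm T) = e (k + 1) S T ^ p)
    (hnondeg : ∀ k (T : geomTorsion W ((p ^ k : ℕ) : ℤ)), (∀ S, e k S T = 1) → T = 0)
    -- binders of the tower representation over `F = L_w` (relative to `F₀ = ℚ_v`) — the stub's own
    (hinj : (bdRPeriodRingData (F := (w.1.adicCompletion (CyclotomicField m ℚ))) (p := p) hL).CupLogInjective (logCyclotomic p)
      ((restrictedRationalTateRep W (Place.Completion (Sum.inr ((primesEquiv (R := 𝓞 ℚ)).symm ⟨p, hp.out⟩) : Place ℚ)) p).restrict (absGaloisRestrict (Place.Completion (Sum.inr ((primesEquiv (R := 𝓞 ℚ)).symm ⟨p, hp.out⟩) : Place ℚ)) (w.1.adicCompletion (CyclotomicField m ℚ)))))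
    (hde : ∀ z : contOneCocycles ((restrictedRationalTateRep W (Place.Completion (Sum.inr ((primesEquiv (R := 𝓞 ℚ)).symm ⟨p, hp.out⟩) : Place ℚ)) p).restrict (absGaloisRestrict (Place.Completion (Sum.inr ((primesEquiv (R := 𝓞 ℚ)).symm ⟨p, hp.out⟩) : Place ℚ)) (w.1.adicCompletion (CyclotomicField m ℚ)))).toTopRep,
      (bdRPeriodRingData (F := (w.1.adicCompletion (CyclotomicField m ℚ))) (p := p) hL).HasDualExp (logCyclotomic p)
        ((restrictedRationalTateRep W (Place.Completion (Sum.inr ((primesEquiv (R := 𝓞 ℚ)).symm ⟨p, hp.out⟩) : Place ℚ)) p).restrict (absGaloisRestrict (Place.Completion (Sum.inr ((primesEquiv (R := 𝓞 ℚ)).symm ⟨p, hp.out⟩) : Place ℚ)) (w.1.adicCompletion (CyclotomicField m ℚ)))) fun σ => z.1 σ)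
    -- line data at `ℚ_v` and `L_w` with their compatibility — the stub's own
    (d₀ : (bdRPeriodRingData (F := (Place.Completion (Sum.inr ((primesEquiv (R := 𝓞 ℚ)).symm ⟨p, hp.out⟩) : Place ℚ))) (p := p) (valuation_place_lt_one p ((primesEquiv (R := 𝓞 ℚ)).symm ⟨p, hp.out⟩))).FilZeroLine (restrictedRationalTateRep W (Place.Completion (Sum.inr ((primesEquiv (R := 𝓞 ℚ)).symm ⟨p, hp.out⟩) : Place ℚ)) p))
    (d : (bdRPeriodRingData (F := (w.1.adicCompletion (CyclotomicField m ℚ))) (p := p) hL).FilZeroLine ((restrictedRationalTateRep W (Place.Completion (Sum.inr ((primesEquiv (R := 𝓞 ℚ)).symm ⟨p, hp.out⟩) : Place ℚ)) p).restrict (absGaloisRestrict (Place.Completion (Sum.inr ((primesEquiv (R := 𝓞 ℚ)).symm ⟨p, hp.out⟩) : Place ℚ)) (w.1.adicCompletion (CyclotomicField m ℚ)))))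
    (hcomp : ∀ (η₀ : contOneCocycles (restrictedTateRep W (Place.Completion (Sum.inr ((primesEquiv (R := 𝓞 ℚ)).symm ⟨p, hp.out⟩) : Place ℚ)) p).toTopRep)
        (η : contOneCocycles ((restrictedTateRep W (Place.Completion (Sum.inr ((primesEquiv (R := 𝓞 ℚ)).symm ⟨p, hp.out⟩) : Place ℚ)) p).restrict (absGaloisRestrict (Place.Completion (Sum.inr ((primesEquiv (R := 𝓞 ℚ)).symm ⟨p, hp.out⟩) : Place ℚ)) (w.1.adicCompletion (CyclotomicField m ℚ)))).toTopRep),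
        (∀ σ, η.1 σ = η₀.1 (absGaloisRestrict (Place.Completion (Sum.inr ((primesEquiv (R := 𝓞 ℚ)).symm ⟨p, hp.out⟩) : Place ℚ)) (w.1.adicCompletion (CyclotomicField m ℚ)) σ)) →
        expStarCoordTower W hL d η = algebraMap (Place.Completion (Sum.inr ((primesEquiv (R := 𝓞 ℚ)).symm ⟨p, hp.out⟩) : Place ℚ)) (w.1.adicCompletion (CyclotomicField m ℚ)) (expStarCoord W (valuation_place_lt_one p ((primesEquiv (R := 𝓞 ℚ)).symm ⟨p, hp.out⟩)) d₀ η₀))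
    -- Kato's formula over `K′` for the DIRECT representation: for every line datum SOME constant (the (K₂)^ram road's output shape)
    (hrecK' : ∀ d'' : (bdRPeriodRingData (F := (w'.1.adicCompletion K)) (p := p) hp').FilZeroLine (restrictedRationalTateRep W (w'.1.adicCompletion K) p), ∃ c' : (w'.1.adicCompletion K),
      ∀ (η'' : contOneCocycles (restrictedTateRep W (w'.1.adicCompletion K) p).toTopRep) (P' : (W.baseChange (w'.1.adicCompletion K)).toAffine.Point),
      ((tatePairingPoint W (w'.1.adicCompletion K) p e hμ hadd₁ hadd₂ hgal hcompat (oneCocycleClass _ η'') P' : ℤ_[p]) : ℚ_[p]) =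
        Algebra.trace ℚ_[p] (w'.1.adicCompletion K) (c' * expStarCoord W hp' d'' η'' * padicLogPointFiniteExt ω' (W.baseChange (w'.1.adicCompletion K)) p P')),
    ∃ c₀ : (Place.Completion (Sum.inr ((primesEquiv (R := 𝓞 ℚ)).symm ⟨p, hp.out⟩) : Place ℚ)), c₀ ≠ 0 ∧
      (∀ (η₀ : contOneCocycles (restrictedTateRep W (Place.Completion (Sum.inr ((primesEquiv (R := 𝓞 ℚ)).symm ⟨p, hp.out⟩) : Place ℚ)) p).toTopRep) (P₀ : (W.baseChange (Place.Completion (Sum.inr ((primesEquiv (R := 𝓞 ℚ)).symm ⟨p, hp.out⟩) : Place ℚ))).toAffine.Point),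
        ((tatePairingPoint W (Place.Completion (Sum.inr ((primesEquiv (R := 𝓞 ℚ)).symm ⟨p, hp.out⟩) : Place ℚ)) p e hμ hadd₁ hadd₂ hgal hcompat (oneCocycleClass _ η₀) P₀ : ℤ_[p]) : ℚ_[p]) =
          Algebra.trace ℚ_[p] (Place.Completion (Sum.inr ((primesEquiv (R := 𝓞 ℚ)).symm ⟨p, hp.out⟩) : Place ℚ))
            (c₀ * expStarCoord W (valuation_place_lt_one p ((primesEquiv (R := 𝓞 ℚ)).symm ⟨p, hp.out⟩)) d₀ η₀ * padicLogPointFiniteExt wv (W.baseChange (Place.Completion (Sum.inr ((primesEquiv (R := 𝓞 ℚ)).symm ⟨p, hp.out⟩) : Place ℚ))) p P₀)) ∧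
      ∀ (η : contOneCocycles ((restrictedTateRep W (Place.Completion (Sum.inr ((primesEquiv (R := 𝓞 ℚ)).symm ⟨p, hp.out⟩) : Place ℚ)) p).restrict (absGaloisRestrict (Place.Completion (Sum.inr ((primesEquiv (R := 𝓞 ℚ)).symm ⟨p, hp.out⟩) : Place ℚ)) (w.1.adicCompletion (CyclotomicField m ℚ)))).toTopRep)
        (P : (W.baseChange (w.1.adicCompletion (CyclotomicField m ℚ))).toAffine.Point),
        ((tatePairingPointTower W (Place.Completion (Sum.inr ((primesEquiv (R := 𝓞 ℚ)).symm ⟨p, hp.out⟩) : Place ℚ)) e hμ hadd₁ hadd₂ hgal hcompat (oneCocycleClass _ η) P : ℤ_[p]) : ℚ_[p]) =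
          Algebra.trace ℚ_[p] (w.1.adicCompletion (CyclotomicField m ℚ))
            (algebraMap (Place.Completion (Sum.inr ((primesEquiv (R := 𝓞 ℚ)).symm ⟨p, hp.out⟩) : Place ℚ)) (w.1.adicCompletion (CyclotomicField m ℚ)) c₀ * expStarCoordTower W hL d η * padicLogPointFiniteExt ν (W.baseChange (w.1.adicCompletion (CyclotomicField m ℚ))) p P) :=
  recTowerAt_cyclotomic_of_formula_over_completion W p (isDeRham_place_of_potGoodFiveSeven W p hp57 hadd hirr hK) m w hw hL

end Summit.BirchSwinnertonDyer.BirchSwinnertonDyer.Theorems.RecTowerAtCyclotomicOverCompletionOfIsDeRham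

end
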